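import Literature.MathematicalPhysics.QuantumLattice.FermiRG.FKTLaddersSec1

/-!
# Feldman–Knörrer–Trubowitz, *Particle–Hole Ladders*: sector counting ("at most `3⁴` choices of `s'`")

Theorem-only companion of the typer file `FKTLaddersSec1.lean` (F7a, frozen; nothing there is edited)
for the cell `gate-hubbard-kl` (seat hubbard-kl-t10; dag g6 re-point item (3)(i), 2026-08-26): the
SECTOR-GEOMETRY step of the proof of Lemma II.16 (`\lemLADresectornorm`, the tree's named fact
`FKTLadders.ResectorizationNormBound`, licence F-075) of J. Feldman, H. Knörrer, E. Trubowitz,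
*Particle–Hole Ladders*, Commun. Math. Phys. **247** (2004) 179–194, arXiv:math-ph/0209044
[FeldmanKnorrerTrubowitz2004Ladders].  Locators `p.N Ln` = chunk `pNNNN.txt` line `n` of the
materialised arXiv TeX, as in F7a.

The printed proof of Lemma II.16 opens (p.13 L48–53): "First observe that, for any fixed `s₁,…,s₄`,
there are at most `3⁴` choices of `(s'₁,…,s'₄)` for which the integral
`∫ ∏_ν (dx'_ν χ̂_{s_ν}(⋯)) f(⋯)` fails to vanish identically, because `f` is sectorized and `ℓ' < ℓ`,
`r' < r`."  The paper gives no further argument.  Two facts are packed into that sentence: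

* (support) the `ν`-th convolution vanishes unless the extended sectors `s̃_ν` (scale `ℓ`, length
  `𝔩_ℓ`) and `s̃'_ν` (scale `ℓ'`, length `𝔩_{ℓ'} ≥ 𝔩_ℓ`) intersect — an analytic statement about the
  Fourier support of sectorized functions, NOT in this file (companion `FKTLaddersSupportVanishing`);
* (geometry) for a fixed sector `s` of a sectorization of length `𝔩_ℓ`, at most `3` sectors `s'` of a
  sectorization of length `𝔩_{ℓ'} ≥ 𝔩_ℓ` have `s̃ ∩ s̃' ≠ ∅` — THIS file, derived from Definition I.2 (ii)
  (`IsSectorization`, p.4 L154–164) and the frame/scale requirements (`FermiFrame.Admissible`,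
  `ScaleData.Admissible`) alone.

## The argument (ours; the paper leaves it to the reader)

An intersection `s̃ ∩ s̃' ≠ ∅` in `𝔐 = ℝ × ℝ²` projects by `π_F` to a common ARCLENGTH PARAMETER of the
two defining intervals (`memArc`).  Conversely, if two distinct intervals `I ≠ I'` of a sectorization `Σ`
of length `𝔩` share a parameter interval `[c, d]` with `d - c ≤ length(F)`, then every `θ ∈ [c, d]`
puts the Fermi-curve point `(0, γ(θ))` in `sector I ∩ sector I'` (this uses only `range γ = F`,
`π_F ∘ γ = id mod length(F)` and `φ(0) = 1`), so the upper overlap bound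
`|s ∩ s' ∩ F| ≤ 𝔩/8` of Definition I.2 (ii) forces `d - c ≤ 𝔩/8` — here `|·|` is the tree's
`FermiFrame.arcLengthIn`, the Lebesgue measure of a `length(F)`-periodic parameter set traced on
`[0, length(F))`, which dominates `d - c` (`ofReal_sub_le_volume_of_periodic`).  Consequently integer
LIFTS `[a, a + 𝔩]`, `[a', a' + 𝔩]` of two distinct sectors of `Σ` satisfy `|a - a'| ≥ 7𝔩/8`
(`lift_gap`).  If an interval `J` with `|J| + 𝔩 < N · 7𝔩/8` meets `N + 1` sectors of `Σ`, their lifts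
through the meeting parameters all start in the window `[J₁ - 𝔩, J₁ + |J|]`, and the pigeonhole
`a ↦ ⌊(a - (J₁ - 𝔩)) / (7𝔩/8)⌋ ∈ {0, …, N-1}` produces two lifts closer than `7𝔩/8` — contradiction
(`card_le_of_meets`).  With `|J| ≤ 𝔩` this gives `N = 3` (`2𝔩 < 21𝔩/8`), and with `|J| = 0` (a single
parameter) `N = 2`: every momentum lies in at most two extended sectors of one sectorization
(`card_filter_mem_extSector_le_two`).  Only the clauses `length_eq`, `length_pos`, `length_lt` and the
UPPER half of `overlap` of `IsSectorization` are used (not `covers`, not `two_neighbours`).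

## Contents

§A arcs and lifts (`memArc_add_int_mul`, `exists_lift_of_memArc`), the periodic-measure lemma;
§B Fermi-curve points lie in every sector whose interval contains their parameter
(`curvePoint_mem_sector`, `curvePoint_mem_extSector`), `sector_subset_extSector`, and the lifted overlap
bound `sub_le_div_eight_of_Icc_subset`; §C `lift_gap`, `card_le_of_meets`, `card_le_three_of_meets`,
`card_le_two_of_memArc`; §D the statements consumed by the Lemma II.16 line:
`card_filter_extSector_inter_nonempty_le_three` (per leg, for `LadderData.Admissible` data and scales
`1 ≤ ℓ' ≤ ℓ`), `card_filter_mem_extSector_le_two`, the product form over the label sum of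
`resectFour` (`card_filter_labels_le_pow`, `≤ 3 ^ 4`, via the generic `card_filter_piFinset_le_pow`).
Theorem-only: no `def`, no named fact, no `instance`, no `notation`;
nothing about the Hubbard model is asserted.
-/

noncomputable section

open MeasureTheory Set

namespace Literature.MathematicalPhysics.QuantumLattice.FermiRG

namespace FKTLadders

/-! ### §A Arcs, lifts, and the measure of a periodic parameter set -/

/-- `memArc` is invariant under integer multiples of the period (intervals on the closed Fermi curve are
read modulo `length(F)`). [cite: FeldmanKnorrerTrubowitz2004Ladders, Definition I.2 (i) (p.4 L144–151)] -/
theorem memArc_add_int_mul (fr : FermiFrame) (I : Arc) (θ : ℝ) (m : ℤ) :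
    fr.memArc I (θ + m * fr.len) ↔ fr.memArc I θ := by
  constructor
  · rintro ⟨n, hn⟩
    refine ⟨m + n, ?_⟩
    have h : θ + ((m + n : ℤ) : ℝ) * fr.len = θ + (m : ℝ) * fr.len + (n : ℝ) * fr.len := by
      push_cast; ring
    rw [h]; exact hn
  · rintro ⟨n, hn⟩
    refine ⟨n - m, ?_⟩
    have h : θ + (m : ℝ) * fr.len + ((n - m : ℤ) : ℝ) * fr.len = θ + (n : ℝ) * fr.len := by
      push_cast; ring
    rw [h]; exact hn

/-- A lift of an arc through one of its parameters: `memArc I θ` gives an integer translate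
`a = I₁ - n·len` of the start with `θ ∈ [a, a + |I|]`. [cite: FeldmanKnorrerTrubowitz2004Ladders, Definition I.2 (i) (p.4 L144–151)] -/
theorem exists_lift_of_memArc {fr : FermiFrame} {I : Arc} {θ : ℝ} (h : fr.memArc I θ) :
    ∃ n : ℤ, θ ∈ Icc (I.1 - n * fr.len) (I.1 - n * fr.len + I.2) := by
  obtain ⟨n, hn⟩ := h
  exact ⟨n, ⟨by linarith [hn.1], by linarith [hn.2]⟩⟩

/-- Conversely every parameter of a lifted interval `[I₁ - n·len, I₁ - n·len + |I|]` belongs to the arc.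
[cite: FeldmanKnorrerTrubowitz2004Ladders, Definition I.2 (i) (p.4 L144–151)] -/
theorem memArc_of_mem_Icc_lift {fr : FermiFrame} {I : Arc} {θ : ℝ} (n : ℤ)
    (h : θ ∈ Icc (I.1 - n * fr.len) (I.1 - n * fr.len + I.2)) : fr.memArc I θ :=
  ⟨n, ⟨by linarith [h.1], by linarith [h.2]⟩⟩

/-- An arc contains its own lifted interval `[I₁, I₁ + |I|]`.
[cite: FeldmanKnorrerTrubowitz2004Ladders, Definition I.2 (i) (p.4 L144–151)] -/
theorem memArc_of_mem_Icc {fr : FermiFrame} {I : Arc} {θ : ℝ} (h : θ ∈ Icc I.1 (I.1 + I.2)) :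
    fr.memArc I θ :=
  ⟨0, by simpa using h⟩

/-- **Measure of a periodic set in the fundamental window.**  If a `len`-periodic property of real
numbers holds on an interval `[c, d]` with `d - c ≤ len`, then the set of parameters in `[0, len)` with
the property has Lebesgue measure at least `d - c` (its trace contains two disjoint translates of pieces
of `[c, d]` of total length `d - c`); this is how the arclength `|s ∩ s' ∩ F|` of Definition I.2 (ii)
(`FermiFrame.arcLengthIn`, traced on `[0, length(F))`) is bounded below by a parameter interval.
[cite: FeldmanKnorrerTrubowitz2004Ladders, Definition I.2 (ii) (p.4 L160–161)] -/
theorem ofReal_sub_le_volume_of_periodic {len : ℝ} (hlen : 0 < len) {P : ℝ → Prop}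
    (hP : ∀ (θ : ℝ) (n : ℤ), P θ → P (θ + n * len)) {c d : ℝ} (hdc : d - c ≤ len)
    (hsub : ∀ θ ∈ Icc c d, P θ) :
    ENNReal.ofReal (d - c) ≤ volume {θ : ℝ | θ ∈ Ico 0 len ∧ P θ} := by
  obtain ⟨n, hn1, hn2⟩ : ∃ n : ℤ, (n : ℝ) * len ≤ c ∧ c < ((n : ℝ) + 1) * len :=
    ⟨⌊c / len⌋, by rw [← le_div_iff₀ hlen]; exact Int.floor_le _,
      by rw [← div_lt_iff₀ hlen]; exact Int.lt_floor_add_one _⟩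
  -- first piece: the translate by `-n·len` of `[c, d]`, cut at `len`
  have h1 : Ico (c - n * len) (min (d - n * len) len) ⊆ {θ : ℝ | θ ∈ Ico 0 len ∧ P θ} := by
    intro θ hθ
    have hθ2 : θ < min (d - n * len) len := hθ.2
    refine ⟨⟨by linarith [hθ.1], lt_of_lt_of_le hθ2 (min_le_right _ _)⟩, ?_⟩
    have hθd : θ < d - n * len := lt_of_lt_of_le hθ2 (min_le_left _ _)
    have key := hP _ (-n) (hsub (θ + n * len) ⟨by linarith [hθ.1], by linarith⟩)
    have h : θ + (n : ℝ) * len + ((-n : ℤ) : ℝ) * len = θ := by push_cast; ring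
    rwa [h] at key
  -- second piece: the part of the translate by `-(n+1)·len` inside `[0, len)`
  have h2 : Ico 0 (d - n * len - len) ⊆ {θ : ℝ | θ ∈ Ico 0 len ∧ P θ} := by
    intro θ hθ
    refine ⟨⟨hθ.1, by linarith [hθ.2]⟩, ?_⟩
    have key := hP _ (-(n + 1))
      (hsub (θ + ((n : ℝ) + 1) * len) ⟨by linarith [hθ.1], by linarith [hθ.2]⟩)
    have h : θ + ((n : ℝ) + 1) * len + ((-(n + 1) : ℤ) : ℝ) * len = θ := by push_cast; ring
    rwa [h] at key
  have hdisj : Disjoint (Ico (c - n * len) (min (d - n * len) len)) (Ico 0 (d - n * len - len)) :=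
    Set.disjoint_left.2 fun θ hθ1 hθ2 => by linarith [hθ1.1, hθ2.2]
  have hvol : volume (Ico (c - n * len) (min (d - n * len) len) ∪ Ico 0 (d - n * len - len)) =
      ENNReal.ofReal (d - c) := by
    rw [measure_union hdisj measurableSet_Ico, Real.volume_Ico, Real.volume_Ico]
    rcases le_total (d - n * len) len with h | h
    · rw [min_eq_left h, ENNReal.ofReal_of_nonpos (by linarith : d - n * len - len - 0 ≤ 0),
        add_zero]
      congr 1; ring
    · rw [min_eq_right h, ← ENNReal.ofReal_add (by linarith) (by linarith)]
      congr 1; ring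
  calc ENNReal.ofReal (d - c)
      = volume (Ico (c - n * len) (min (d - n * len) len) ∪ Ico 0 (d - n * len - len)) := hvol.symm
    _ ≤ volume {θ : ℝ | θ ∈ Ico 0 len ∧ P θ} := measure_mono (union_subset h1 h2)

/-! ### §B Fermi-curve points, sectors, and the lifted overlap bound -/

section Frame

variable {S : ScaleData} {e : (Fin 2 → ℝ) → ℝ} {fr : FermiFrame} {re : ℕ}

/-- Points `γ(θ)` of an admissible frame lie on the Fermi curve: `e(γ θ) = 0`.
[cite: FeldmanKnorrerTrubowitz2004Ladders, Definition I.2 (p.4 L144–151), with §I.2 (p.4 L87)] -/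
theorem e_gamma_eq_zero (hfr : fr.Admissible S e re) (θ : ℝ) : e (fr.γ θ) = 0 := by
  have hγ : fr.γ θ ∈ fermiCurve e := by rw [← hfr.range_eq]; exact mem_range_self θ
  simpa [fermiCurve] using hγ

/-- A Fermi-curve point `(0, γ θ)` lies in every `j`-th neighbourhood (`φ(0) = 1 ≠ 0`).
[cite: FeldmanKnorrerTrubowitz2004Ladders, Definition I.1 (ii) (p.4 L116–130)] -/
theorem curvePoint_mem_nbhd (hS : S.Admissible) (hfr : fr.Admissible S e re) (j : ℕ) (θ : ℝ) :
    ((0 : ℝ), fr.γ θ) ∈ nbhd S e j := by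
  have h1 : S.φ 0 = 1 := hS.eq_one 0 (by norm_num)
  simp [nbhd, nbhdFn, e_gamma_eq_zero hfr θ, h1]

/-- A Fermi-curve point `(0, γ θ)` lies in every `j`-th extended neighbourhood.
[cite: FeldmanKnorrerTrubowitz2004Ladders, Definition I.1 (ii) (p.4 L131–135)] -/
theorem curvePoint_mem_extNbhd (hS : S.Admissible) (hfr : fr.Admissible S e re) (j : ℕ) (θ : ℝ) :
    ((0 : ℝ), fr.γ θ) ∈ extNbhd S e j := by
  have h1 : S.φ 0 = 1 := hS.eq_one 0 (by norm_num)
  simp [extNbhd, extNbhdFn, e_gamma_eq_zero hfr θ, h1]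

/-- `π_F(0, γ θ) ≡ θ (mod length(F))`, so arc membership of the projection is arc membership of `θ`.
[cite: FeldmanKnorrerTrubowitz2004Ladders, Definition I.2 (p.4 L151)] -/
theorem memArc_proj_curvePoint (hfr : fr.Admissible S e re) {I : Arc} {θ : ℝ} :
    fr.memArc I (fr.πF ((0 : ℝ), fr.γ θ)) ↔ fr.memArc I θ := by
  obtain ⟨n, hn⟩ := hfr.proj_id θ
  rw [hn, memArc_add_int_mul]

/-- A Fermi-curve point whose parameter lies in the interval `I` belongs to the sector of `I` at every
scale. [cite: FeldmanKnorrerTrubowitz2004Ladders, Definition I.2 (i) (p.4 L144–151)] -/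
theorem curvePoint_mem_sector (hS : S.Admissible) (hfr : fr.Admissible S e re) (j : ℕ) {I : Arc}
    {θ : ℝ} (h : fr.memArc I θ) : ((0 : ℝ), fr.γ θ) ∈ sector S e fr j I :=
  ⟨curvePoint_mem_nbhd hS hfr j θ, (memArc_proj_curvePoint hfr).2 h⟩

/-- A Fermi-curve point whose parameter lies in `I` belongs to the extended sector of `I` at every
scale. [cite: FeldmanKnorrerTrubowitz2004Ladders, Definition I.6 (p.5 L115–119)] -/
theorem curvePoint_mem_extSector (hS : S.Admissible) (hfr : fr.Admissible S e re) (j : ℕ) {I : Arc}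
    {θ : ℝ} (h : fr.memArc I θ) : ((0 : ℝ), fr.γ θ) ∈ extSector S e fr j I :=
  ⟨curvePoint_mem_extNbhd hS hfr j θ, (memArc_proj_curvePoint hfr).2 h⟩

/-- The `j`-th neighbourhood is contained in the `j`-th extended neighbourhood (`φ` is non-increasing on
`[0, ∞)` and `M ≥ 1`). [cite: FeldmanKnorrerTrubowitz2004Ladders, Definition I.1 (ii) (p.4 L127–135)] -/
theorem nbhd_subset_extNbhd (hS : S.Admissible) (j : ℕ) : nbhd S e j ⊆ extNbhd S e j := by
  intro k hk
  simp only [nbhd, extNbhd, Function.mem_support, nbhdFn, extNbhdFn, ne_eq] at hk ⊢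
  set t : ℝ := k.1 ^ 2 + e k.2 ^ 2 with ht
  have ht0 : 0 ≤ t := by positivity
  have hM : 1 ≤ S.M := hS.one_lt_M.le
  have hle : S.M ^ ((2 * j : ℤ) - 2) * t ≤ S.M ^ ((2 * j : ℤ) - 1) * t :=
    mul_le_mul_of_nonneg_right (zpow_le_zpow_right₀ hM (by omega)) ht0
  have h0 : 0 ≤ S.M ^ ((2 * j : ℤ) - 2) * t := mul_nonneg (zpow_nonneg (by linarith) _) ht0
  have hanti := hS.antitoneOn h0 (le_trans h0 hle) hle
  have hpos : 0 < S.φ (S.M ^ ((2 * j : ℤ) - 1) * t) :=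
    lt_of_le_of_ne (hS.mem_Icc _).1 (Ne.symm hk)
  exact ne_of_gt (lt_of_lt_of_le hpos hanti)

/-- Sectors are contained in their extensions: `s ⊆ s̃`.
[cite: FeldmanKnorrerTrubowitz2004Ladders, Definition I.6 (p.5 L115–119)] -/
theorem sector_subset_extSector (hS : S.Admissible) (j : ℕ) (I : Arc) :
    sector S e fr j I ⊆ extSector S e fr j I :=
  fun _ hk => ⟨nbhd_subset_extNbhd hS j hk.1, hk.2⟩

/-- **The overlap bound of Definition I.2 (ii) in lifted form.**  If two DISTINCT intervals of a
sectorization of length `𝔩` both contain every parameter of `[c, d]`, `d - c ≤ length(F)`, then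
`d - c ≤ 𝔩/8`: the Fermi-curve points over `[c, d]` lie in `s ∩ s' ∩ F`, whose arclength is at most
`𝔩/8`. [cite: FeldmanKnorrerTrubowitz2004Ladders, Definition I.2 (ii) (p.4 L154–161)] -/
theorem sub_le_div_eight_of_Icc_subset (hS : S.Admissible) (hfr : fr.Admissible S e re) {j : ℕ}
    {𝔩 : ℝ} {Γ : Finset Arc} (hΓ : IsSectorization S e fr j 𝔩 Γ) {I I' : Arc} (hI : I ∈ Γ)
    (hI' : I' ∈ Γ) (hne : I' ≠ I) {c d : ℝ} (hcd : c ≤ d) (hdc : d - c ≤ fr.len)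
    (hsub : ∀ θ ∈ Icc c d, fr.memArc I θ ∧ fr.memArc I' θ) : d - c ≤ 𝔩 / 8 := by
  have hc := hsub c (left_mem_Icc.2 hcd)
  have hne' : (sector S e fr j I ∩ sector S e fr j I').Nonempty :=
    ⟨((0 : ℝ), fr.γ c), curvePoint_mem_sector hS hfr j hc.1, curvePoint_mem_sector hS hfr j hc.2⟩
  have hov := (hΓ.overlap I hI I' hI' hne hne').2
  unfold FermiFrame.arcLengthIn at hov
  have hper : ∀ (θ : ℝ) (n : ℤ), ((0 : ℝ), fr.γ θ) ∈ sector S e fr j I ∩ sector S e fr j I' →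
      ((0 : ℝ), fr.γ (θ + n * fr.len)) ∈ sector S e fr j I ∩ sector S e fr j I' := by
    intro θ n h
    rwa [hfr.periodic.int_mul n θ]
  have hle := ofReal_sub_le_volume_of_periodic hfr.len_pos hper hdc
    (fun θ hθ => ⟨curvePoint_mem_sector hS hfr j (hsub θ hθ).1,
      curvePoint_mem_sector hS hfr j (hsub θ hθ).2⟩)
  exact (ENNReal.ofReal_le_ofReal_iff (by linarith [hΓ.length_pos])).1 (hle.trans hov)

/-! ### §C Lifts of distinct sectors are `7𝔩/8` apart; counting the sectors an interval can meet -/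

/-- **Gap between lifts.**  If `[a, a + 𝔩]` and `[a', a' + 𝔩]`, `a ≤ a'`, are lifted intervals of two
distinct sectors of a sectorization of length `𝔩`, then `a' ≥ a + 7𝔩/8`.
[cite: FeldmanKnorrerTrubowitz2004Ladders, Definition I.2 (ii) (p.4 L154–161)] -/
theorem lift_gap (hS : S.Admissible) (hfr : fr.Admissible S e re) {j : ℕ} {𝔩 : ℝ} {Γ : Finset Arc}
    (hΓ : IsSectorization S e fr j 𝔩 Γ) {I I' : Arc} (hI : I ∈ Γ) (hI' : I' ∈ Γ) (hne : I' ≠ I)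
    {a a' : ℝ} (ha : ∀ θ ∈ Icc a (a + 𝔩), fr.memArc I θ)
    (ha' : ∀ θ ∈ Icc a' (a' + 𝔩), fr.memArc I' θ) (hle : a ≤ a') : a + 7 * 𝔩 / 8 ≤ a' := by
  by_contra hlt
  rw [not_le] at hlt
  have h𝔩 := hΓ.length_pos
  have h := sub_le_div_eight_of_Icc_subset hS hfr hΓ hI hI' hne (c := a') (d := a + 𝔩)
    (by linarith) (by linarith [hΓ.length_lt]) (fun θ hθ =>
      ⟨ha θ ⟨by linarith [hθ.1], hθ.2⟩, ha' θ ⟨hθ.1, by linarith [hθ.2]⟩⟩)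
  linarith

/-- **Counting by pigeonhole.**  Let `Σ` be a sectorization of length `𝔩` and `J` an interval with
`|J| + 𝔩 < N · 7𝔩/8`.  Then at most `N` sectors of `Σ` have a parameter in common with `J`.
[cite: FeldmanKnorrerTrubowitz2004Ladders, Definition I.2 (ii) (p.4 L154–164)] -/
theorem card_le_of_meets (hS : S.Admissible) (hfr : fr.Admissible S e re) {j : ℕ} {𝔩 : ℝ}
    {Γ : Finset Arc} (hΓ : IsSectorization S e fr j 𝔩 Γ) (J : Arc) (N : ℕ)
    (hN : J.2 + 𝔩 < N * (7 * 𝔩 / 8)) (F : Finset Arc) (hF : F ⊆ Γ)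
    (hmeet : ∀ I ∈ F, ∃ θ, fr.memArc J θ ∧ fr.memArc I θ) : F.card ≤ N := by
  classical
  have h𝔩 := hΓ.length_pos
  -- Step 1: a lift `[a_I, a_I + 𝔩]` of each `I ∈ F` through a parameter of the lift `[J₁, J₁ + |J|]`.
  have hlift : ∀ I ∈ F, ∃ a : ℝ, (∀ θ ∈ Icc a (a + 𝔩), fr.memArc I θ) ∧
      J.1 - 𝔩 ≤ a ∧ a ≤ J.1 + J.2 := by
    intro I hI
    obtain ⟨θ, hθJ, hθI⟩ := hmeet I hI
    obtain ⟨n, hn⟩ := hθJ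
    have hθI' : fr.memArc I (θ + n * fr.len) := (memArc_add_int_mul fr I θ n).2 hθI
    obtain ⟨m, hm⟩ := exists_lift_of_memArc hθI'
    have hI2 : I.2 = 𝔩 := hΓ.length_eq I (hF hI)
    rw [hI2] at hm
    refine ⟨I.1 - m * fr.len, fun θ' hθ' => memArc_of_mem_Icc_lift m (by rwa [hI2]), ?_, ?_⟩
    · linarith [hm.2, hn.1]
    · linarith [hm.1, hn.2]
  choose! a ha using hlift
  -- Step 2: pigeonhole on `⌊(a_I - (J₁ - 𝔩)) / (7𝔩/8)⌋ ∈ {0, …, N-1}`.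
  by_contra hcard
  rw [not_le] at hcard
  have hg : 0 < 7 * 𝔩 / 8 := by linarith
  have hmaps : Set.MapsTo (fun I => ⌊(a I - (J.1 - 𝔩)) / (7 * 𝔩 / 8)⌋₊) (F : Set Arc)
      (Finset.range N : Set ℕ) := by
    intro I hI
    have hI' : I ∈ F := by simpa using hI
    obtain ⟨-, h1, h2⟩ := ha I hI'
    simp only [Finset.coe_range, Set.mem_Iio]
    rw [Nat.floor_lt (div_nonneg (by linarith) hg.le), div_lt_iff₀ hg]
    linarith
  obtain ⟨I, hI, I', hI', hne, hEq⟩ :=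
    Finset.exists_ne_map_eq_of_card_lt_of_maps_to (by simpa using hcard) hmaps
  -- Step 3: equal cells ⇒ the two lifts are closer than `7𝔩/8`, contradicting `lift_gap`.
  have key : ∀ {x y : ℝ}, 0 ≤ y → ⌊x⌋₊ = ⌊y⌋₊ → x - y < 1 := by
    intro x y hy h
    have h1 : x < ⌊x⌋₊ + 1 := Nat.lt_floor_add_one x
    have h2 : (⌊y⌋₊ : ℝ) ≤ y := Nat.floor_le hy
    rw [h] at h1
    linarith
  obtain ⟨haI, hI1, -⟩ := ha I hI
  obtain ⟨haI', hI'1, -⟩ := ha I' hI'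
  have hx : 0 ≤ (a I - (J.1 - 𝔩)) / (7 * 𝔩 / 8) := div_nonneg (by linarith) hg.le
  have hy : 0 ≤ (a I' - (J.1 - 𝔩)) / (7 * 𝔩 / 8) := div_nonneg (by linarith) hg.le
  rcases le_total (a I) (a I') with hle | hle
  · have hgap := lift_gap hS hfr hΓ (hF hI) (hF hI') hne.symm haI haI' hle
    have hlt := key hx hEq.symm
    rw [← sub_div, div_lt_one hg] at hlt
    linarith
  · have hgap := lift_gap hS hfr hΓ (hF hI') (hF hI) hne haI' haI hle
    have hlt := key hy hEq
    rw [← sub_div, div_lt_one hg] at hlt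
    linarith

/-- **An interval no longer than the sectors meets at most three of them.**  If `Σ` is a sectorization
of length `𝔩` and `J` an interval of length `|J| ≤ 𝔩`, then at most `3` sectors of `Σ` have a
parameter in common with `J`. [cite: FeldmanKnorrerTrubowitz2004Ladders, Definition I.2 (ii) (p.4 L154–164) and Lemma II.16, proof (p.13 L48–53)] -/
theorem card_le_three_of_meets (hS : S.Admissible) (hfr : fr.Admissible S e re) {j : ℕ} {𝔩 : ℝ}
    {Γ : Finset Arc} (hΓ : IsSectorization S e fr j 𝔩 Γ) (J : Arc) (hJ : J.2 ≤ 𝔩)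
    (F : Finset Arc) (hF : F ⊆ Γ) (hmeet : ∀ I ∈ F, ∃ θ, fr.memArc J θ ∧ fr.memArc I θ) :
    F.card ≤ 3 :=
  card_le_of_meets hS hfr hΓ J 3 (by push_cast; linarith [hΓ.length_pos]) F hF hmeet

/-- **Every parameter lies in at most two sectors of a sectorization.**
[cite: FeldmanKnorrerTrubowitz2004Ladders, Definition I.2 (ii) (p.4 L154–164)] -/
theorem card_le_two_of_memArc (hS : S.Admissible) (hfr : fr.Admissible S e re) {j : ℕ} {𝔩 : ℝ}
    {Γ : Finset Arc} (hΓ : IsSectorization S e fr j 𝔩 Γ) (θ : ℝ) (F : Finset Arc) (hF : F ⊆ Γ)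
    (hmem : ∀ I ∈ F, fr.memArc I θ) : F.card ≤ 2 :=
  card_le_of_meets hS hfr hΓ (θ, 0) 2 (by push_cast; linarith [hΓ.length_pos]) F hF
    (fun I hI => ⟨θ, memArc_of_mem_Icc (by simp), hmem I hI⟩)

end Frame

/-! ### §D The statements used by the Lemma II.16 line -/

/-- Coordinatewise cardinality bounds multiply: if every factor keeps at most `N` elements, the filtered
product keeps at most `N ^ #ι` ("at most `3⁴` choices" from "at most `3` per leg").
[cite: FeldmanKnorrerTrubowitz2004Ladders, Lemma II.16, proof (p.13 L48–53)] -/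
theorem card_filter_piFinset_le_pow {ι : Type*} [Fintype ι] [DecidableEq ι] {α : ι → Type*}
    (t : ∀ i, Finset (α i)) (p : ∀ i, α i → Prop) [∀ i, DecidablePred (p i)] (N : ℕ)
    (h : ∀ i, ((t i).filter (p i)).card ≤ N) :
    ({f ∈ Fintype.piFinset t | ∀ i, p i (f i)}).card ≤ N ^ Fintype.card ι := by
  -- coordinatewise conditions cut a product finset down to a product finset (the tree's
  -- `Literature.Barriers.Parity.Frame.filter_piFinset_forall`, re-proved inline to keep the import cone)
  have heq : {f ∈ Fintype.piFinset t | ∀ i, p i (f i)} = Fintype.piFinset fun i => (t i).filter (p i) := by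
    ext f
    simp only [Finset.mem_filter, Fintype.mem_piFinset]
    exact ⟨fun h i => ⟨h.1 i, h.2 i⟩, fun h => ⟨fun i => (h i).1, fun i => (h i).2⟩⟩
  rw [heq, Fintype.card_piFinset]
  calc ∏ i, ((t i).filter (p i)).card ≤ ∏ _i : ι, N :=
        Finset.prod_le_prod (fun _ _ => Nat.zero_le _) (fun i _ => h i)
    _ = N ^ Fintype.card ι := by simp

/-- The sector length `𝔩_j = M^{-ℵj}` is positive for admissible data.
[cite: FeldmanKnorrerTrubowitz2004Ladders, §I.7 (p.8 L29)] -/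
theorem secLen_pos (D : LadderData) (hD : D.Admissible) (j : ℕ) : 0 < D.secLen j := by
  unfold LadderData.secLen
  have hM : 0 < D.S.M := lt_trans zero_lt_one hD.scale.one_lt_M
  exact inv_pos.2 (Real.rpow_pos_of_pos hM _)

/-- The sector length decreases with the scale: `j' ≤ j ⇒ 𝔩_j ≤ 𝔩_{j'}` (`M > 1`, `ℵ > 0`).
[cite: FeldmanKnorrerTrubowitz2004Ladders, §I.7 (p.8 L29)] -/
theorem secLen_le_secLen (D : LadderData) (hD : D.Admissible) {j j' : ℕ} (h : j' ≤ j) :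
    D.secLen j ≤ D.secLen j' := by
  unfold LadderData.secLen
  have hM1 : 1 ≤ D.S.M := hD.scale.one_lt_M.le
  have hM : 0 < D.S.M := lt_of_lt_of_le zero_lt_one hM1
  have hℵ : 0 ≤ D.aleph := by linarith [hD.aleph_gt]
  have hexp : D.aleph * (j' : ℝ) ≤ D.aleph * (j : ℝ) :=
    mul_le_mul_of_nonneg_left (by exact_mod_cast h) hℵ
  exact inv_anti₀ (Real.rpow_pos_of_pos hM _) (Real.rpow_le_rpow_of_exponent_le hM1 hexp)

/-- For admissible data every interval of `Σ_j` has length `𝔩_j` (`Σ_j` is a sectorization of length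
`𝔩_j` at scale `j`). [cite: FeldmanKnorrerTrubowitz2004Ladders, §I.7 (p.8 L29–31)] -/
theorem snd_eq_secLen (D : LadderData) (hD : D.Admissible) {j : ℕ} (hj : 1 ≤ j) {s : Arc}
    (hs : s ∈ D.Sig j) : s.2 = D.secLen j :=
  (hD.sectorization j hj).length_eq s hs

/-- **Sector counting, per leg ("at most 3 choices of `s'_ν`").**  For admissible ladder data, scales
`1 ≤ ℓ' ≤ ℓ` and a sector `s ∈ Σ_ℓ`, at most `3` sectors `s' ∈ Σ_{ℓ'}` have extension meeting the
extension of `s`: `#{s' ∈ Σ_{ℓ'} : s̃ ∩ s̃' ≠ ∅} ≤ 3`.  This is the geometric half of "there are at most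
`3⁴` choices of `(s'₁,…,s'₄)` for which the integral fails to vanish identically" in the proof of
Lemma II.16. [cite: FeldmanKnorrerTrubowitz2004Ladders, Lemma II.16, proof (p.13 L48–53); Definition I.2 (ii) (p.4 L154–164)] -/
theorem card_filter_extSector_inter_nonempty_le_three (D : LadderData) (hD : D.Admissible)
    {l l' : ℕ} (hl' : 1 ≤ l') (hll : l' ≤ l) {s : Arc} (hs : s ∈ D.Sig l)
    [DecidablePred fun s' : Arc =>
      (extSector D.S D.e D.fr l s ∩ extSector D.S D.e D.fr l' s').Nonempty] :
    ((D.Sig l').filter fun s' =>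
        (extSector D.S D.e D.fr l s ∩ extSector D.S D.e D.fr l' s').Nonempty).card ≤ 3 := by
  have hl : 1 ≤ l := hl'.trans hll
  have hs2 : s.2 = D.secLen l := snd_eq_secLen D hD hl hs
  refine card_le_three_of_meets hD.scale hD.frame (hD.sectorization l' hl') s
    (by rw [hs2]; exact secLen_le_secLen D hD hll) _ (Finset.filter_subset _ _) ?_
  intro s' hs'
  obtain ⟨k, hk, hk'⟩ := (Finset.mem_filter.1 hs').2
  exact ⟨D.fr.πF k, hk.2, hk'.2⟩

/-- The same count with plain sectors on either side (`s ⊆ s̃`).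
[cite: FeldmanKnorrerTrubowitz2004Ladders, Lemma II.16, proof (p.13 L48–53)] -/
theorem card_filter_sector_inter_nonempty_le_three (D : LadderData) (hD : D.Admissible)
    {l l' : ℕ} (hl' : 1 ≤ l') (hll : l' ≤ l) {s : Arc} (hs : s ∈ D.Sig l)
    [DecidablePred fun s' : Arc => (sector D.S D.e D.fr l s ∩ sector D.S D.e D.fr l' s').Nonempty] :
    ((D.Sig l').filter fun s' =>
        (sector D.S D.e D.fr l s ∩ sector D.S D.e D.fr l' s').Nonempty).card ≤ 3 := by
  have hl : 1 ≤ l := hl'.trans hll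
  have hs2 : s.2 = D.secLen l := snd_eq_secLen D hD hl hs
  refine card_le_three_of_meets hD.scale hD.frame (hD.sectorization l' hl') s
    (by rw [hs2]; exact secLen_le_secLen D hD hll) _ (Finset.filter_subset _ _) ?_
  intro s' hs'
  obtain ⟨k, hk, hk'⟩ := (Finset.mem_filter.1 hs').2
  exact ⟨D.fr.πF k, hk.2, hk'.2⟩

/-- **Every momentum lies in at most two extended sectors of `Σ_j`.**
[cite: FeldmanKnorrerTrubowitz2004Ladders, Definition I.2 (ii) (p.4 L154–164)] -/
theorem card_filter_mem_extSector_le_two (D : LadderData) (hD : D.Admissible) {j : ℕ} (hj : 1 ≤ j)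
    (k : SpT) [DecidablePred fun s : Arc => k ∈ extSector D.S D.e D.fr j s] :
    ((D.Sig j).filter fun s => k ∈ extSector D.S D.e D.fr j s).card ≤ 2 :=
  card_le_two_of_memArc hD.scale hD.frame (hD.sectorization j hj) (D.fr.πF k) _
    (Finset.filter_subset _ _) (fun _ hs => (Finset.mem_filter.1 hs).2.2)

/-- **Every momentum lies in at most two sectors of `Σ_j`.**
[cite: FeldmanKnorrerTrubowitz2004Ladders, Definition I.2 (ii) (p.4 L154–164)] -/
theorem card_filter_mem_sector_le_two (D : LadderData) (hD : D.Admissible) {j : ℕ} (hj : 1 ≤ j)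
    (k : SpT) [DecidablePred fun s : Arc => k ∈ sector D.S D.e D.fr j s] :
    ((D.Sig j).filter fun s => k ∈ sector D.S D.e D.fr j s).card ≤ 2 :=
  card_le_two_of_memArc hD.scale hD.frame (hD.sectorization j hj) (D.fr.πF k) _
    (Finset.filter_subset _ _) (fun _ hs => (Finset.mem_filter.1 hs).2.2)

open scoped Classical in
/-- **Sector counting over the label sum of a resectorization ("at most `3⁴` choices").**  In
`resectFour D jl jr jl' jr' f i y s` (Definition I.18) the old labels `s'` run over
`∏_μ (if chg μ then Σ_{old scale of μ} else {s μ})`; if the old scales are coarser (`jl ≤ jl'`,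
`jr ≤ jr'`, all `≥ 1`) and the new labels `s μ` of the changed legs are sectors of the new scales, then
at most `3 ^ 4` label vectors `s'` have `s̃_μ ∩ s̃'_μ ≠ ∅` on every changed leg `μ`.
[cite: FeldmanKnorrerTrubowitz2004Ladders, Lemma II.16, proof (p.13 L48–53); Definition I.18 (p.8 L55–93)] -/
theorem card_filter_labels_le_pow (D : LadderData) (hD : D.Admissible) {jl jr jl' jr' : ℕ}
    (hjl : 1 ≤ jl) (hl : jl ≤ jl') (hjr : 1 ≤ jr) (hr : jr ≤ jr') (s : Fin 4 → Arc)
    (chg : Fin 4 → Prop) [DecidablePred chg]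
    (hs : ∀ μ, chg μ → s μ ∈ (if μ.val < 2 then D.Sig jl' else D.Sig jr')) :
    ({s' ∈ Fintype.piFinset fun μ : Fin 4 =>
          if chg μ then (if μ.val < 2 then D.Sig jl else D.Sig jr) else {s μ} |
        ∀ μ, chg μ →
          (extSector D.S D.e D.fr (if μ.val < 2 then jl' else jr') (s μ) ∩
            extSector D.S D.e D.fr (if μ.val < 2 then jl else jr) (s' μ)).Nonempty}).card ≤ 3 ^ 4 := by
  have h := card_filter_piFinset_le_pow
    (fun μ : Fin 4 => if chg μ then (if μ.val < 2 then D.Sig jl else D.Sig jr) else {s μ})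
    (fun μ I => chg μ →
      (extSector D.S D.e D.fr (if μ.val < 2 then jl' else jr') (s μ) ∩
        extSector D.S D.e D.fr (if μ.val < 2 then jl else jr) I).Nonempty) 3 ?_
  · simpa using h
  intro μ
  by_cases hc : chg μ
  · rw [if_pos hc]
    by_cases hμ : μ.val < 2
    · have hsμ : s μ ∈ D.Sig jl' := by simpa [hμ] using hs μ hc
      have h3 := @card_filter_extSector_inter_nonempty_le_three D hD _ _ hjl hl _ hsμ
        (fun _ => Classical.propDecidable _)
      refine le_trans (Finset.card_le_card fun I hI => ?_) h3
      simp only [Finset.mem_filter] at hI ⊢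
      simpa [hμ] using And.intro hI.1 (hI.2 hc)
    · have hsμ : s μ ∈ D.Sig jr' := by simpa [hμ] using hs μ hc
      have h3 := @card_filter_extSector_inter_nonempty_le_three D hD _ _ hjr hr _ hsμ
        (fun _ => Classical.propDecidable _)
      refine le_trans (Finset.card_le_card fun I hI => ?_) h3
      simp only [Finset.mem_filter] at hI ⊢
      simpa [hμ] using And.intro hI.1 (hI.2 hc)
  · rw [if_neg hc]
    exact (Finset.card_le_card (Finset.filter_subset _ _)).trans (by simp)

end FKTLadders

end Literature.MathematicalPhysics.QuantumLattice.FermiRG
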